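import Summits.BirchSwinnertonDyer.BirchSwinnertonDyer.Theorems.PrintX9MuPartStubH5bAtSOfNonanomalous
import Literature.NumberTheory.EllipticCurves.AnticyclotomicHeegnerPlacesDecompositionProofs
import Literature.NumberTheory.EllipticCurves.ZpExtensionEisensteinOrdinaryInvariantsBoundProofs
import Literature.NumberTheory.EllipticCurves.ZpExtensionEisensteinSelmerH5bMultiplicativeThreeProofs
import HarnessLib

/-!
# H.5(b) at tower level `0` at the places `v ∣ 3` on the twin frame (MULTIPLICATIVE reduction above `3`) — x10b's letter
# `Stmt.h5bAtSZeroP` at `p = 3` for the twin of crux 24737 (helper, THEOREMS ONLY: no definition, no named fact, no instance, no `sorry`)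

Helper toward the registered stub `stub_howardOutputsOfFamily` (K2) of line `beta-road` (skeleton v10 cd44fe9d5c6b9a78) of crux r205
stmt-BirchSwinnertonDyer-24737 `…Theses.UniversalToricDescent.TwinAlgMuZeroAtThree` (LEAD lineage `bsd-wall-utd-p1`, g25): the fourth
SUMMITS-side brick of the twin's E2 (H-twin) assembly.  x10b-p1-w8's frame packaging `HeegnerMuPartH5bAtS.h5bAtSZeroP_of_clauseP`
(`Theorems/PrintX9MuPartStubH5bAtSZeroP`) + closer `stub_h5bAtSZeroP` take good ORDINARY reduction at `w ∣ p` from `hyp.ordinary`; on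
the TWIN frame (`K` imaginary quadratic, `κ` anticyclotomic, `K` Heegner for `N`, multiplicative reduction of `W_K` above `3`) the clause is
`eisensteinDVRSetting_h5b_clause_zero_of_mem_three_of_hasMultiplicativeReductionAt` (p757264) and the packaging is verbatim otherwise:
`h5bAtSZeroThree_of_hasMultiplicativeReductionAt`.  Bookkeeping toward one stub of one crux; no summit statement is proved; BSD is not
proved by any of this.
-/

set_option linter.dupNamespace false
set_option autoImplicit false

noncomputable section

open scoped Classical Pointwise ContRepresentation TensorProduct NumberField

open Function NumberField IsDedekindDomain Field
open Literature Literature.NumberTheory.EllipticCurves WeierstrassCurve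
open Literature.NumberTheory.GaloisCohomology Literature.NumberTheory.GaloisCohomology.Howard2004
open Literature.NumberTheory.Automorphic
open Literature.NumberTheory.GaloisRepresentations Literature.NumberTheory.GaloisRepresentations.DiscreteGaloisModule
open Summit.BirchSwinnertonDyer.BirchSwinnertonDyer.Theorems

namespace Summit.BirchSwinnertonDyer.BirchSwinnertonDyer.Theorems.UniversalToricDescentTwinH5bAtSZeroThree

set_option synthInstance.maxHeartbeats 80000 in
set_option maxHeartbeats 1600000 in
/-- **H.5(b), tower level `0`, at one place `v ∈ S` above `3`, on the twin frame** (x10b's letter `Stmt.h5bAtSZeroP` at `p = 3` with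
multiplicative reduction above `3`): threshold `m₁ := max_{w ∈ S} (5·3^{s_w} + 1)` from the (B4) elements `κ⁻(g_w) = 3^{s_w}`
(`decomp_not_le_kerSubgroup_of_mem_or_mem`: Heegner + `S ⊆ {v ∣ 3N}`), anticyclotomy of `κ⁻` along the transported complex
conjugation, and the clause `eisensteinDVRSetting_h5b_clause_zero_of_mem_three_of_hasMultiplicativeReductionAt`.
[cite: Howard2004HeegnerKolyvagin, §1.3 H.5(b), §2.2, Def. 3.1.2, §3.1 (arXiv:1202.6340 p. 7 L96–97, p. 15–16)] [cite: Brink2007, Thm. 2 and Cor. 1] -/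
theorem h5bAtSZeroThree_of_hasMultiplicativeReductionAt :
  ∀ (N : ℕ) [NeZero N] (W : WeierstrassCurve ℚ) [W.IsElliptic] (K : Type) [Field K] [NumberField K]
    (κ : ZpExtension K 3),
    IsImaginaryQuadratic K → κ.IsAnticyclotomic → SatisfiesHeegnerHypothesis N K →
    (∀ w : HeightOneSpectrum (𝓞 K), ((3 : ℕ) : 𝓞 K) ∈ w.asIdeal → (W.baseChange K).HasMultiplicativeReductionAt w) →
    ∀ (S : Finset (HeightOneSpectrum (𝓞 K)))
      (hpS : ∀ v, ((3 : ℕ) : 𝓞 K) ∈ v.asIdeal → v ∈ S)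
      (hbad : ∀ v, v ∉ S → ((3 : ℕ) : 𝓞 K) ∉ v.asIdeal → (W.baseChange K).HasGoodReductionAt v),
    (∀ v ∈ S, ((3 : ℕ) : 𝓞 K) ∈ v.asIdeal ∨ ((N : ℕ) : 𝓞 K) ∈ v.asIdeal) →
    (∀ (σ : K ≃ₐ[ℚ] K) (v : HeightOneSpectrum (𝓞 K)), σ • v ∈ S → v ∈ S) →
    ∀ v ∈ S, ((3 : ℕ) : 𝓞 K) ∈ v.asIdeal →
    ∃ m₁ : ℕ, ∀ (m : ℕ) (hm : 1 ≤ m), m₁ < m →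
      letI := IwasawaAlgebra.isDomain_quotient_X_pow_add_C 3 hm
      letI := IwasawaAlgebra.isDiscreteValuationRing_quotient_X_pow_add_C 3 hm
      haveI := IwasawaAlgebra.EisensteinCoeff.isLocalRing_succ 3 hm
      letI := IwasawaAlgebra.EisensteinCoeff.algebraOfSpecSucc 3 m
      haveI := W.isScalarTower_algebraOfSpecSucc (K := K) (p := 3) (m := m)
      letI := W.residueModuleSucc (K := K) (p := 3) hm
      ∀ (π : ∀ v : HeightOneSpectrum (𝓞 K), TamePin v) (L : Set (HeightOneSpectrum (𝓞 K)))
        (hL : L ⊆ (W.eisensteinTower (κ.unitTwist (-1)) hm).degreeTwoPrimes 3) (hLS : ∀ v ∈ L, v ∉ S)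
        (jbar' : AlgebraicClosure K →+* ℂ)
        (c₀ : absoluteGaloisGroup ℚ) (σ : K ≃ₐ[ℚ] K) (hσ₁ : σ ≠ 1) (hσ : σ * σ = 1)
        (hτl : IsLiftOfAut σ (absGaloisTransport (K := ℚ) (L := K) c₀).toRingEquiv)
        (hτ₂ : Function.Involutive (absGaloisTransport (K := ℚ) (L := K) c₀).toRingEquiv)
        (D : ∀ k, DualityDatum 3 (ConjugationDatum.ofLifts σ hσ₁ hσ _ hτl hτ₂)
          ((W.eisensteinTower (κ.unitTwist (-1)) hm).ρ k) (IwasawaAlgebra.EisensteinCoeff 3 m (k + 1)))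
        (e : ∀ j : ℕ, geomTorsion (W.baseChange K) (((3 : ℕ) : ℤ) ^ j) →+ geomTorsion (W.baseChange K) (((3 : ℕ) : ℤ) ^ j) →+
          MuCarrier K (3 ^ j))
        (log : ∀ j : ℕ, MuCarrier K (3 ^ j) →+ ZMod (3 ^ j)),
        IsComplexConjugation (Rat.castHom ℝ) c₀ →
        (∀ x, (ConjugationDatum.ofLifts σ hσ₁ hσ _ hτl hτ₂).τ x = absGaloisTransport (K := ℚ) (L := K) c₀ x) →
        (∀ k, (D k).e = ZpExtension.eisensteinDualityForm hm (k + 1)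
          (conjPairing (e (k + 1)) ((ConjugationDatum.ofLifts σ hσ₁ hσ _ hτl hτ₂).isLift.torsionMap W _)
            (log (k + 1)))) →
        (∀ j a, e j a a = 0) →
        (∀ j (g : absoluteGaloisGroup K) a b, e j (g • a) (g • b) = mu K (3 ^ j) g (e j a b)) →
        (∀ j a b, e j ((ConjugationDatum.ofLifts σ hσ₁ hσ _ hτl hτ₂).isLift.torsionMap W _ a)
          ((ConjugationDatum.ofLifts σ hσ₁ hσ _ hτl hτ₂).isLift.torsionMap W _ b) = -e j a b) →
        (∀ j (a : geomTorsion (W.baseChange K) (((3 : ℕ) : ℤ) ^ j)),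
          (ConjugationDatum.ofLifts σ hσ₁ hσ _ hτl hτ₂).isLift.torsionMap W _
            ((ConjugationDatum.ofLifts σ hσ₁ hσ _ hτl hτ₂).isLift.torsionMap W _ a) = a) →
        (∀ j, Function.Bijective (log j)) →
        (∀ j (g : absoluteGaloisGroup K) ξ, log j (mu K (3 ^ j) g ξ) = cyclotomicCharacterModPow K 3 j g * log j ξ) →
          (((W.isQuotientBy_eisensteinDVRSetting_πbar (κ.unitTwist (-1)) hm S hpS hbad L hL hLS jbar'
              (ConjugationDatum.ofLifts σ hσ₁ hσ _ hτl hτ₂) D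
              (W.eisensteinLevelsTameFs (κ.unitTwist (-1)) hm π S hpS hbad L hL hLS)
              0).propagateStructure (W.eisensteinTowerTriple (κ.unitTwist (-1)) hm S hpS hbad L hL hLS 0).cond)
              (Sum.inr (σ • v))).map
              (((W.residualTauGeomTorsion (p := 3) (ConjugationDatum.ofLifts σ hσ₁ hσ _ hτl hτ₂) hm (k := 0 + 1)
                  (Nat.succ_pos 0)).thetaH1 (Sum.inr v)).comp
                ((ConjugationDatum.ofLifts σ hσ₁ hσ _ hτl hτ₂).transportH1
                  ((W.baseChange K).torsionGaloisModule ((3 : ℕ) : ℤ)) v)) =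
            ((W.isQuotientBy_eisensteinDVRSetting_πbar (κ.unitTwist (-1)) hm S hpS hbad L hL hLS jbar'
              (ConjugationDatum.ofLifts σ hσ₁ hσ _ hτl hτ₂) D
              (W.eisensteinLevelsTameFs (κ.unitTwist (-1)) hm π S hpS hbad L hL hLS)
              0).propagateStructure (W.eisensteinTowerTriple (κ.unitTwist (-1)) hm S hpS hbad L hL hLS 0).cond)
              (Sum.inr v) := by
  intro N _ W _ K _ _ κ hK hanti₀ hHeeg hmultw S hpS hbad hSN hSσ v hvS hpv
  haveI : IsTotallyComplex K := hK.isTotallyComplex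
  classical
  have hantiκ : (κ.unitTwist (-1)).IsAnticyclotomic := hanti₀.unitTwist (-1)
  -- every place of `S` is finitely decomposed in `K_∞^−/K`: the (B4) elements `κ⁻(g_w) = p^{s_w}`
  have hdec : ∀ w ∈ S, ¬ (GreenbergSelmer.decomp w ≤ (κ.unitTwist (-1)).kerSubgroup) :=
    ZpExtension.decomp_not_le_kerSubgroup_of_mem_or_mem hK (κ.unitTwist (-1)) hantiκ hHeeg (NeZero.ne N) hSN
  have hsg : ∀ w ∈ S, ∃ (sw : ℕ) (g₀ : absoluteGaloisGroup (w.adicCompletion K)),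
      ((κ.unitTwist (-1)) (absGaloisRestrict K (w.adicCompletion K) g₀)).toAdd = ((3 ^ sw : ℕ) : ℤ_[3]) :=
    fun w hw ↦
      ZpExtension.exists_toAdd_apply_absGaloisRestrict_eq_pow_of_not_decomp_le (κ.unitTwist (-1)) w (hdec w hw)
  choose! s g hg using hsg
  refine ⟨S.sup (fun w ↦ 5 * 3 ^ s w + 1), fun m hm hlt ↦ ?_⟩
  letI := IwasawaAlgebra.isDomain_quotient_X_pow_add_C 3 hm
  letI := IwasawaAlgebra.isDiscreteValuationRing_quotient_X_pow_add_C 3 hm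
  haveI := IwasawaAlgebra.EisensteinCoeff.isLocalRing_succ 3 hm
  letI := IwasawaAlgebra.EisensteinCoeff.algebraOfSpecSucc 3 m
  haveI := W.isScalarTower_algebraOfSpecSucc (K := K) (p := 3) (m := m)
  letI := W.residueModuleSucc (K := K) (p := 3) hm
  intro π L hL hLS jbar' c₀ σ hσ₁ hσ hτl hτ₂ D e log hc₀ hτ hDe h4' h5' h6' h7' h8' h9'
  -- `σ v ∈ S`, `p ∈ σ v`
  have hσvS : σ • v ∈ S := hSσ σ _ (by rwa [smul_smul, hσ, one_smul])
  have hpσv : ((3 : ℕ) : 𝓞 K) ∈ (σ • v).asIdeal := (natCast_mem_smul_asIdeal_iff (K := K) (p := 3) σ v).2 hpv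
  have hloc : ∀ w ∈ ({v, (ConjugationDatum.ofLifts σ hσ₁ hσ _ hτl hτ₂).σ • v} : Set (HeightOneSpectrum (𝓞 K))),
      w ∈ S ∧ ((3 : ℕ) : 𝓞 K) ∈ w.asIdeal := by
    intro w hw
    rcases hw with hw | hw
    · rw [hw]
      exact ⟨hvS, hpv⟩
    · rw [Set.mem_singleton_iff] at hw
      rw [hw]
      exact ⟨hσvS, hpσv⟩
  -- MULTIPLICATIVE reduction of `E_K` at `w ∣ 3` (the twin frame)
  have hmult : ∀ w ∈ ({v, (ConjugationDatum.ofLifts σ hσ₁ hσ _ hτl hτ₂).σ • v} : Set (HeightOneSpectrum (𝓞 K))),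
      (W.baseChange K).HasMultiplicativeReductionAt w := fun w hw ↦ hmultw w (hloc w hw).2
  -- `κ⁻(τ⁻¹ g τ) = −κ⁻(g)` for the transported complex conjugation
  have hanti : ∀ g' : absoluteGaloisGroup K,
      ((κ.unitTwist (-1)) ((ConjugationDatum.ofLifts σ hσ₁ hσ _ hτl hτ₂).conj g')).toAdd =
        -((κ.unitTwist (-1)) g').toAdd :=
    fun g' ↦ ZpExtension.toAdd_conjGalCMH_eq_neg (κ.unitTwist (-1)) hantiκ (fun w ↦ IsTotallyComplex.isComplex w)
      (ConjugationDatum.ofLifts σ hσ₁ hσ _ hτl hτ₂).isLift hc₀ hτ g'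
  exact W.eisensteinDVRSetting_h5b_clause_zero_of_mem_three_of_hasMultiplicativeReductionAt (κ.unitTwist (-1)) hm S hpS hbad L
    hL hLS jbar' σ hσ₁ hσ _ hτl hτ₂ D (W.eisensteinLevelsTameFs (κ.unitTwist (-1)) hm π S hpS hbad L hL hLS) hpv hpσv hmult hanti
    (fun w hw ↦ hg w (hloc w hw).1)
    (fun w hw ↦ (Finset.le_sup (f := fun w ↦ 5 * 3 ^ s w + 1) (hloc w hw).1).trans hlt.le)

end Summit.BirchSwinnertonDyer.BirchSwinnertonDyer.Theorems.UniversalToricDescentTwinH5bAtSZeroThree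

end
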